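/-
Copyright (c) 2026. All rights reserved.
Released under Apache 2.0 license as described in the file LICENSE.
Authors: HodgeCM publication cell (pub-hodgecm), GR lane, third hand (`pub-hodgecm-own-crow`).
-/
import Literature.NumberTheory.Weil1964.AdelicMetaplecticUnitaryLegContinuity
import Literature.NumberTheory.Weil1964.AdelicMetaplecticUnitaryLegL2
import Literature.NumberTheory.Weil1964.AdelicMetaplecticL2ScaledIsometries
import Literature.NumberTheory.Weil1964.AdelicSchrodingerL2Dense
import Literature.NumberTheory.Automorphic.UnitaryGroupOfFormAdelicTopology
import HarnessLib

/-!
# Strong continuity of the unitary leg of `Mp_ψ(W_𝐀)ᶜᵒⁿᵗ` along homomorphisms from adelic unitary groups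

Topic `NumberTheory/Weil1964`; namespace `Literature.NumberTheory.Weil1964`.  KERNEL ONLY: theorems; no definition, no named
fact, nothing of [Weil1964] or [GelbartRogawski1991] asserted.

[GelbartRogawski1991, Prop. 3.1.1 p. 455 L1–2] asks for a CONTINUOUS section `s : G(𝐀) → Mp_𝐀(W)` of the metaplectic
cover over the adelic unitary group `G(𝐀)`; in print's topology on `Mp_𝐀(W)` (pairs `(g, M_g)` of bounded operators on the
space of `ρ_ψ`) the operator half of "continuous" is the strong continuity `g ↦ M_{s g} f`.  The tree's sections are
homomorphisms `s : U(𝐀) →* Mp_ψ(W_𝐀)ᶜᵒⁿᵗ` (`adelicMpCont`, LF-continuous implementers on `𝒮(𝐀_Fⁿ)`) continuous for the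
COEFFICIENT topology (`AdelicMetaplecticGroup` §4) — e.g. the compatible splittings of `GRConstruction.gru_shape` on the
dual-pair carrier `U(J_V ⊗ J_W)(𝐀_F) = UnitaryGroup.adelicPair …` — and the passage to bounded operators is the unitary leg
`adelicMpCont.unitaryLeg i …` on an `L²(ν)`-normed completion `i : 𝒮(𝐀_Fⁿ) →ₗ H` (`AdelicMetaplecticUnitaryLeg`), in
particular `adelicMpCont.unitaryLegL2` on `H = L²(𝐀_Fⁿ, ν)` (`AdelicMetaplecticUnitaryLegL2`).

`AdelicMetaplecticUnitaryLegContinuity.adelicMpCont.continuous_toOp_unitaryLeg_comp_hom` proves the strong continuity of the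
leg along every coefficient-continuous homomorphism from a second-countable locally compact metrizable group (Riesz /
Brezis–Lieb + Steinhaus–Weil; NO square-integrable majorant, NO sign condition at the real places).  This file instantiates
it on the groups of record, whose topological hypotheses are `UnitaryGroupOfFormAdelicTopology`:

* §1 the two remaining inputs of the `L²` leg, DISCHARGED: `denseRange_schwartzBruhatToL2` (density of `𝒮(𝐀_F^ι)` in
  `L²(ν)`, from `AdelicSchrodingerL2Dense.dense_piSchwartzBruhat`) and
  `adelicMpCont.toOp_mem_scaledIsometries_schwartzBruhatToL2` (every `p ∈ Mp_ψ(W_𝐀)ᶜᵒⁿᵗ` is a scaled `[·]`-isometry, from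
  `AdelicMetaplecticL2ScaledIsometries`), so that `adelicMpCont.unitaryLegL2 ν T hψc hβc hd hall` is available with
  `hd := denseRange_schwartzBruhatToL2 ν`, `hall := adelicMpCont.toOp_mem_scaledIsometries_schwartzBruhatToL2 T hT ν`;
* §2 **`adelicMpCont.continuous_toOp_unitaryLeg_comp_unitaryGroupHom`** — for ANY quadratic-extension data `E/F`, `c`, any
  finite index type `κ`, any `J ∈ M_κ(𝐀_E)` and any continuous homomorphism
  `s : U(c ⊗ 1, J)(𝐀) →* Mp_ψ(W_𝐀)ᶜᵒⁿᵗ`, every orbit map `g ↦ U_{s g} f` of the abstract leg is continuous; the named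
  carriers: `…_comp_adelicHom` (`UnitaryGroup.adelic F E c N J`), `…_comp_adelicPairHom` (`UnitaryGroup.adelicPair`);
* §3 the same for the `L²` leg: **`adelicMpCont.continuous_toOp_unitaryLegL2_comp_unitaryGroupHom`**,
  `…_comp_adelicPairHom`, `…_comp_adelicPairHom_comp_adelicInl` (restriction to the first factor `U(J_V)(𝐀_F)` along
  `g ↦ g ⊗ 1`).

Scope: the operator half only; the `Sp`-half `g ↦ π(s g) w` of print's topology is the continuity of `π ∘ s = ι`, part of
the splitting datum.  The majorant route of `AdelicMetaplecticL2Continuity(Section)` / `ArchDualPairL2Continuity` (GR-2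
lane) reaches the same continuity for the sign profiles covered by the tree's `KAK` data; this route has no such restriction.

## References
* [GelbartRogawski1991] S. Gelbart, J. Rogawski, Invent. Math. 105 (1991) 445–472, §3.1 p. 454 L19–40, Prop. 3.1.1
  p. 455 L1–2, §3.2 p. 457.
* [Weil1964] A. Weil, Acta Math. 111 (1964) 143–211, Chap. I n° 11, n° 13 p. 160, Chap. III n° 37, n° 39 p. 189.
* [HewittRoss1979] E. Hewitt, K. A. Ross, *Abstract Harmonic Analysis I*, 2nd ed. (1979), Thm. 22.18.
-/

set_option autoImplicit false

noncomputable section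

open scoped Matrix Kronecker ENNReal
open NumberField MeasureTheory

namespace Literature.NumberTheory.Weil1964

open Literature.NumberTheory.Automorphic Literature.RepresentationTheory.HeisenbergGroup
open Literature.RepresentationTheory.Unitary

/-! ## §1 The inputs `hd`, `hall` of the `L²` leg, discharged -/

section Inputs

variable {F : Type} [Field F] [NumberField F] {ι : Type} [Fintype ι] [DecidableEq ι]
variable [MeasurableSpace (AdeleRing (𝓞 F) F)] [BorelSpace (AdeleRing (𝓞 F) F)]
  (ν : Measure (ι → AdeleRing (𝓞 F) F)) [ν.IsAddHaarMeasure]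

/-- **`𝒮(𝐀_F^ι)` is dense in `L²(𝐀_F^ι, ν)` through the class map `[·]`** — the input `hd` of
`adelicMpCont.unitaryLegL2` (`AdelicSchrodingerL2Dense.dense_piSchwartzBruhat` read through
`denseRange_schwartzBruhatToL2_of_dense`). [cite: Weil1964, Chap. I n° 11] -/
theorem denseRange_schwartzBruhatToL2 : DenseRange (schwartzBruhatToL2 F ι ν) :=
  denseRange_schwartzBruhatToL2_of_dense ν (dense_piSchwartzBruhat F ι ν)

variable {n : ℕ} (T : Matrix (Fin n) (Fin n) (AdeleRing (𝓞 F) F)) (hT : IsUnit T.det)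
  (ν : Measure (Fin n → AdeleRing (𝓞 F) F)) [ν.IsAddHaarMeasure]

include hT in
/-- **every `p ∈ Mp_ψ(W_𝐀)ᶜᵒⁿᵗ` is a scaled `[·]`-isometry of `L²(𝐀_Fⁿ, ν)`** — the input `hall` of
`adelicMpCont.unitaryLegL2` (`AdelicMetaplecticL2ScaledIsometries.adelicMpCont.toOp_mem_scaledIsometries_of_norm_sq_eq_lintegral`
at `i = [·]`, whose norm is `‖[Φ]‖ = √(∫⁻ ‖Φ‖ₑ² dν)`). [cite: Weil1964, Chap. I n° 13 p. 160, Chap. III n° 37] -/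
theorem adelicMpCont.toOp_mem_scaledIsometries_schwartzBruhatToL2 (p : adelicMpCont F (Fin n) T) :
    adelicMpCont.toOp F (Fin n) T p ∈ scaledIsometries (schwartzBruhatToL2 F (Fin n) ν) :=
  adelicMpCont.toOp_mem_scaledIsometries_of_norm_sq_eq_lintegral F T hT ν (schwartzBruhatToL2 F (Fin n) ν)
    (fun Φ => by rw [norm_schwartzBruhatToL2_eq_sqrt, Real.sq_sqrt ENNReal.toReal_nonneg]) p

end Inputs

/-! ## §2 The abstract leg along homomorphisms from `U(c ⊗ 1, J)(𝐀)` -/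

section Abstract

variable (F : Type) [Field F] [NumberField F] {n : ℕ}
  (T : Matrix (Fin n) (Fin n) (AdeleRing (𝓞 F) F)) (hT : IsUnit T.det)
  [MeasurableSpace (AdeleRing (𝓞 F) F)] [BorelSpace (AdeleRing (𝓞 F) F)]
  (ν : Measure (Fin n → AdeleRing (𝓞 F) F)) [ν.IsAddHaarMeasure]
  {H : Type*} [NormedAddCommGroup H] [NormedSpace ℂ H] [CompleteSpace H]
  (i : piSchwartzBruhat F (Fin n) →ₗ[ℂ] H)
  (hi : ∀ Φ : piSchwartzBruhat F (Fin n),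
    ‖i Φ‖ ^ 2 = (∫⁻ x, ‖(Φ : (Fin n → AdeleRing (𝓞 F) F) → ℂ) x‖ₑ ^ 2 ∂ν).toReal)
  (hd : DenseRange i)
  (hall : ∀ p : adelicMpCont F (Fin n) T, adelicMpCont.toOp F (Fin n) T p ∈ scaledIsometries i)
  (ρH : Representation ℂ (AdelicHeisenberg F (Fin n) T) H) (hρc : ∀ h, Continuous (ρH h))
  (hρi : ∀ (h : AdelicHeisenberg F (Fin n) T) (Φ : piSchwartzBruhat F (Fin n)),
    ρH h (i Φ) = i (adelicSchrodinger F (Fin n) T h Φ))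
  {E : Type} [Field E] [NumberField E] [Algebra F E] (c : E ≃ₐ[F] E)
  {κ : Type} [Fintype κ] [DecidableEq κ] (J : Matrix κ κ (AdeleRing (𝓞 E) E))

include hT hi in
/-- **STRONG CONTINUITY OF THE UNITARY LEG ALONG A CONTINUOUS HOMOMORPHISM FROM AN ADELIC UNITARY GROUP**: for every
continuous `s : U(c ⊗ 1, J)(𝐀) →* Mp_ψ(W_𝐀)ᶜᵒⁿᵗ` (coefficient topology) and every `f ∈ H`, `g ↦ U_{s g} f` is continuous —
`U(c ⊗ 1, J)(𝐀)` being a second-countable locally compact metrizable group (`UnitaryGroupOfFormAdelicTopology`), the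
Steinhaus–Weil route `adelicMpCont.continuous_toOp_unitaryLeg_comp_hom` applies (with its Borel `σ`-algebra).
[cite: GelbartRogawski1991, Prop. 3.1.1 p. 455 L1–2] [cite: HewittRoss1979, Thm. 22.18] -/
theorem adelicMpCont.continuous_toOp_unitaryLeg_comp_unitaryGroupHom
    (s : unitaryGroupOfForm (UnitaryGroup.conjAdele F E c) J →* adelicMpCont F (Fin n) T) (hs : Continuous s) (f : H) :
    Continuous fun g => MpPsi.toOp ρH (adelicMpCont.unitaryLeg i hd hall ρH hρc hρi (s g)) f := by
  borelize ↥(unitaryGroupOfForm (UnitaryGroup.conjAdele F E c) J)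
  exact adelicMpCont.continuous_toOp_unitaryLeg_comp_hom F T hT ν i hi s (continuous_subtype_val.comp hs) hd hall ρH
    hρc hρi f

variable (N M : ℕ) (JN : Matrix (Fin N) (Fin N) E) (JV : Matrix (Fin N) (Fin N) E) (JW : Matrix (Fin M) (Fin M) E)

include hT hi in
/-- the same along a continuous `s : U(J)(𝐀_F) →* Mp_ψ(W_𝐀)ᶜᵒⁿᵗ` (`UnitaryGroup.adelic F E c N J`).
[cite: GelbartRogawski1991, Prop. 3.1.1 p. 455 L1–2] [cite: HewittRoss1979, Thm. 22.18] -/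
theorem adelicMpCont.continuous_toOp_unitaryLeg_comp_adelicHom
    (s : UnitaryGroup.adelic F E c N JN →* adelicMpCont F (Fin n) T) (hs : Continuous s) (f : H) :
    Continuous fun g => MpPsi.toOp ρH (adelicMpCont.unitaryLeg i hd hall ρH hρc hρi (s g)) f :=
  adelicMpCont.continuous_toOp_unitaryLeg_comp_unitaryGroupHom F T hT ν i hi hd hall ρH hρc hρi c
    (UnitaryGroup.adelicForm E N JN) s hs f

include hT hi in
/-- the same along a continuous `s : U(J_V ⊗ J_W)(𝐀_F) →* Mp_ψ(W_𝐀)ᶜᵒⁿᵗ` on the dual-pair carrier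
(`UnitaryGroup.adelicPair F E c N M J_V J_W`) — the shape of the compatible splittings of
[GelbartRogawski1991, Prop. 3.1.1] in the tree (`SplittingDatum.CompatibleSplitting`, `GRConstruction.gru_shape`).
[cite: GelbartRogawski1991, Prop. 3.1.1 p. 455 L1–2, §3.2 p. 457] [cite: HewittRoss1979, Thm. 22.18] -/
theorem adelicMpCont.continuous_toOp_unitaryLeg_comp_adelicPairHom
    (s : UnitaryGroup.adelicPair F E c N M JV JW →* adelicMpCont F (Fin n) T) (hs : Continuous s) (f : H) :
    Continuous fun g => MpPsi.toOp ρH (adelicMpCont.unitaryLeg i hd hall ρH hρc hρi (s g)) f :=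
  adelicMpCont.continuous_toOp_unitaryLeg_comp_unitaryGroupHom F T hT ν i hi hd hall ρH hρc hρi c
    (UnitaryGroup.adelicForm E N JV ⊗ₖ UnitaryGroup.adelicForm E M JW) s hs f

end Abstract

/-! ## §3 The `L²` leg along homomorphisms from `U(c ⊗ 1, J)(𝐀)` -/

section L2

variable (F : Type) [Field F] [NumberField F] {n : ℕ}
  (T : Matrix (Fin n) (Fin n) (AdeleRing (𝓞 F) F)) (hT : IsUnit T.det)
  [MeasurableSpace (AdeleRing (𝓞 F) F)] [BorelSpace (AdeleRing (𝓞 F) F)]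
  (ν : Measure (Fin n → AdeleRing (𝓞 F) F)) [ν.IsAddHaarMeasure]
  (hψc : Continuous (adeleAddChar F : AdeleRing (𝓞 F) F → Circle))
  (hβc : ∀ y : Fin n → AdeleRing (𝓞 F) F,
    Continuous fun u : Fin n → AdeleRing (𝓞 F) F => adelicForm F (Fin n) T u y)
  (hd : DenseRange (schwartzBruhatToL2 F (Fin n) ν))
  (hall : ∀ p : adelicMpCont F (Fin n) T,
    adelicMpCont.toOp F (Fin n) T p ∈ scaledIsometries (schwartzBruhatToL2 F (Fin n) ν))
  {E : Type} [Field E] [NumberField E] [Algebra F E] (c : E ≃ₐ[F] E)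
  {κ : Type} [Fintype κ] [DecidableEq κ] (J : Matrix κ κ (AdeleRing (𝓞 E) E))

/-- `‖[Φ]‖² = ∫ ‖Φ‖² dν`: the class map is `L²(ν)`-normed. [cite: Weil1964, Chap. I n° 11] -/
theorem norm_schwartzBruhatToL2_sq (Φ : piSchwartzBruhat F (Fin n)) :
    ‖schwartzBruhatToL2 F (Fin n) ν Φ‖ ^ 2 =
      (∫⁻ x, ‖(Φ : (Fin n → AdeleRing (𝓞 F) F) → ℂ) x‖ₑ ^ 2 ∂ν).toReal := by
  rw [norm_schwartzBruhatToL2_eq_sqrt, Real.sq_sqrt ENNReal.toReal_nonneg]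

include hT in
/-- **STRONG CONTINUITY OF THE `L²` LEG ALONG A CONTINUOUS HOMOMORPHISM FROM AN ADELIC UNITARY GROUP**: for every continuous
`s : U(c ⊗ 1, J)(𝐀) →* Mp_ψ(W_𝐀)ᶜᵒⁿᵗ` and every `f ∈ L²(𝐀_Fⁿ, ν)`, `g ↦ U_{s g} f` is continuous (`U` the unitary leg
`adelicMpCont.unitaryLegL2`; any `hd`, `hall`, e.g. those of §1).  No majorant, no sign condition.
[cite: GelbartRogawski1991, Prop. 3.1.1 p. 455 L1–2] [cite: Weil1964, Chap. III n° 39 p. 189] -/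
theorem adelicMpCont.continuous_toOp_unitaryLegL2_comp_unitaryGroupHom
    (s : unitaryGroupOfForm (UnitaryGroup.conjAdele F E c) J →* adelicMpCont F (Fin n) T) (hs : Continuous s)
    (f : Lp ℂ 2 ν) :
    Continuous fun g => MpPsi.toOp _ (adelicMpCont.unitaryLegL2 ν T hψc hβc hd hall (s g)) f :=
  adelicMpCont.continuous_toOp_unitaryLeg_comp_unitaryGroupHom F T hT ν (schwartzBruhatToL2 F (Fin n) ν)
    (norm_schwartzBruhatToL2_sq F ν) hd hall _ (continuous_schrodingerHaar_rep ν T hψc hβc)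
    (schrodingerHaar_rep_schwartzBruhatToL2 ν T hψc hβc) c J s hs f

variable (N M : ℕ) (JV : Matrix (Fin N) (Fin N) E) (JW : Matrix (Fin M) (Fin M) E)

include hT in
/-- **the `L²` leg is strongly continuous along every continuous homomorphism from the dual-pair carrier
`U(J_V ⊗ J_W)(𝐀_F)`** — e.g. along the compatible splittings of [GelbartRogawski1991, Prop. 3.1.1] of the tree, for ALL
hermitian data `J_V`, `J_W`. [cite: GelbartRogawski1991, Prop. 3.1.1 p. 455 L1–2, §3.2 p. 457]
[cite: Weil1964, Chap. III n° 39 p. 189] -/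
theorem adelicMpCont.continuous_toOp_unitaryLegL2_comp_adelicPairHom
    (s : UnitaryGroup.adelicPair F E c N M JV JW →* adelicMpCont F (Fin n) T) (hs : Continuous s) (f : Lp ℂ 2 ν) :
    Continuous fun g => MpPsi.toOp _ (adelicMpCont.unitaryLegL2 ν T hψc hβc hd hall (s g)) f :=
  adelicMpCont.continuous_toOp_unitaryLegL2_comp_unitaryGroupHom F T hT ν hψc hβc hd hall c
    (UnitaryGroup.adelicForm E N JV ⊗ₖ UnitaryGroup.adelicForm E M JW) s hs f

include hT in
/-- … and hence along its restriction `U(J_V)(𝐀_F) → U(J_V ⊗ J_W)(𝐀_F) → Mp_ψ(W_𝐀)ᶜᵒⁿᵗ` to the first member of the dual pair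
(`g ↦ g ⊗ 1`, `UnitaryGroup.adelicInl`, continuous) — the group `G(𝐀)` of [GelbartRogawski1991, Prop. 3.1.1].
[cite: GelbartRogawski1991, Prop. 3.1.1 p. 455 L1–2, §3.2 p. 457] [cite: Weil1964, Chap. III n° 39 p. 189] -/
theorem adelicMpCont.continuous_toOp_unitaryLegL2_comp_adelicPairHom_comp_adelicInl
    (s : UnitaryGroup.adelicPair F E c N M JV JW →* adelicMpCont F (Fin n) T) (hs : Continuous s) (f : Lp ℂ 2 ν) :
    Continuous fun g : UnitaryGroup.adelic F E c N JV =>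
      MpPsi.toOp _ (adelicMpCont.unitaryLegL2 ν T hψc hβc hd hall (s (UnitaryGroup.adelicInl F E c N M JV JW g))) f :=
  (adelicMpCont.continuous_toOp_unitaryLegL2_comp_adelicPairHom F T hT ν hψc hβc hd hall c N M JV JW s hs f).comp
    (UnitaryGroup.continuous_adelicInl F E c N M JV JW)

end L2

end Literature.NumberTheory.Weil1964

end
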